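import Mathlib
import HarnessLib
import Literature.MathematicalPhysics.StatisticalMechanics.FluctuationDefectLipschitz
import Literature.MathematicalPhysics.StatisticalMechanics.StepKernelBoundsABKM

/-!
# The fluctuation defect `D_B(H) = R^{(q)}_{k+1}e^{−H(B)} − e^{−(A^{(q)}_kH)(B)}` for a step kernel BY
# PREDICATE: second-order bound and Lipschitz bound ([ABKM19] Theorem 6.8, `q ∈ B_κ`)

`FluctuationDefect.tayNormLE_fluctDefect_abkm` and `FluctuationDefectLipschitz.tayNormLE_fluctDefect_sub_abkm`
bound the defect of a block for the step kernel EQUAL to the weight kernel `𝒞_{k+1}` (`q = 0`).  Their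
proofs use of the kernel only the facts recorded in `StepKernelBounds` (integration property (w7′),
smoothness of `R_{k+1}F`, integrability, `circulant ⪰ 0`) plus the shift bound `L^{dk}|γ_q| ≤ h²` which
they take as a hypothesis.  This file is their `q`-twin: the same statements and proofs for an
arbitrary kernel `𝒞q` with `StepKernelBounds W L k A𝒫' C₂ 𝒞q` relative to the `q = 0` weights
(the constant `A_𝒫` of (w7) replaced by `A𝒫'`):

* **`tayNormLE_fluctDefect_abkm_of_stepKernelBounds`** — `|D_B(H)|_{k,B} ≤ 256e^{1/4}(A𝒫' + 4)‖H‖²_{k,0}`;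
* **`tayNormLE_fluctDefect_sub_abkm_of_stepKernelBounds`** — the Lipschitz form
  `|D_B(H) − D_B(H')|_{k,B} ≤ 512e^{1/4}(A𝒫' + 4)(‖H‖ + ‖H'‖)‖H − H'‖`.

The `q = 0` statements are recovered with `AbkmWeightBounds.stepKernelBounds`.  Everything is proved;
no named fact.

## References
* S. Adams, S. Buchholz, R. Kotecký, S. Müller, arXiv:1910.13564, Theorem 6.8 ((6.56), (6.61)–(6.64)),
  Lemma 7.7, Lemma 8.4 [AdamsBuchholzKoteckyMuller2019].
-/

noncomputable section


namespace Literature.MathematicalPhysics.StatisticalMechanics.GradientRG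

open scoped BigOperators Classical MatrixOrder
open Finset Matrix MeasureTheory ProbabilityTheory WithLp
open Literature.MathematicalPhysics.QuantumFieldTheory
open Literature.MathematicalPhysics.StatisticalMechanics.GradientFRD (cExt fourierCoeff mulMat)
open Literature.MathematicalPhysics.StatisticalMechanics.TorusPolymer
  (IsPolymer numBlocks blockOf thicken subset_thicken isPolymer_blockOf card_blockOf blocks_blockOf
    card_blocks_eq_numBlocks)
open Literature.Barriers.CriticalPhenomena.LongRangePhi4.Polymer (IsConn)

variable {d M : ℕ} [NeZero M]

/-- **The fluctuation defect is of second order** for the torus data: on the block `B = B_x` at scale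
`k ≤ N` (`d ≥ 2`, `L` odd, `M = L^N`, tower with `AbkmWeightBounds`, `θ̄, λ, δ₀, δ₁ > 0`, `h² ≥ h₀²`,
`⌊d/2⌋+1 ≤ min(p, M_ord)`, shift `L^{dk}|γ_q| ≤ h²` for `γ = gradCov 𝒞_{k+1}`) and `‖H‖_{k,0} ≤ 1/16`
(at `(𝔥_k, L^k, L^{dk})`):
`|D_B(H)|_{k,B,T_φ} ≤ 256e^{1/4}(A_𝒫 + 4)‖H‖²_{k,0} · w_{k:k+1}^B(φ)`.
[cite: AdamsBuchholzKoteckyMuller2019, Theorem 6.8 ((6.56), (6.61)–(6.64))] -/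
theorem tayNormLE_fluctDefect_abkm_of_stepKernelBounds {L N Mord R n p r₀ : ℕ} {θbar lam μ δ₁ δ₀ A𝒫 A𝒫' C₂ h A : ℝ}
    {𝒞 : ℕ → (Fin d → ZMod M) → ℝ} (hd : 2 ≤ d)
    (hB : AbkmWeightBounds L N Mord R n θbar lam μ δ₁ δ₀ A𝒫 𝒞
      (abkmWeightData L N Mord R θbar (schedDelta δ₀ δ₁ N) 𝒞))
    (hLodd : Odd L) (hM : M = L ^ N) {k : ℕ} (hk : k ≤ N)
    {𝒞q : (Fin d → ZMod M) → ℝ} (hS : StepKernelBounds (abkmWeightData L N Mord R θbar (schedDelta δ₀ δ₁ N) 𝒞) L k A𝒫' C₂ 𝒞q) (hδ₀ : 0 < δ₀) (hδ₁ : 0 < δ₁) (hh : 0 < h)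
    (hh0 : hZeroSq d R δ₀ δ₁ ≤ h ^ 2) (hMord : d / 2 + 1 ≤ Mord) (hp : d / 2 + 1 ≤ p)
    (hγ : ∀ q, ((L ^ (d * k) : ℕ) : ℝ) * |gradCov 𝒞q q| ≤ h ^ 2)
    (x : Fin d → ZMod M) {H : RelevantHamiltonian ℂ d}
    (hH : hamNorm (fieldWt h (L : ℝ) d k) ((L : ℝ) ^ k) (L ^ (d * k)) H ≤ 1 / 16) :
    TayNormLE ((abkmNormParams L N Mord R p r₀ h θbar A (schedDelta δ₀ δ₁ N) 𝒞).gauge k (blockOf (L ^ k) x))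
      r₀ ((abkmWeightData L N Mord R θbar (schedDelta δ₀ δ₁ N) 𝒞).midWeight k (blockOf (L ^ k) x))
      (fluctDefect 𝒞q H (blockOf (L ^ k) x))
      (256 * Real.exp (1 / 4) * (A𝒫' + 4) *
        hamNorm (fieldWt h (L : ℝ) d k) ((L : ℝ) ^ k) (L ^ (d * k)) H ^ 2) := by
  set P := abkmNormParams L N Mord R p r₀ h θbar A (schedDelta δ₀ δ₁ N) 𝒞 with hP
  set W := abkmWeightData L N Mord R θbar (schedDelta δ₀ δ₁ N) 𝒞 with hW
  set B := blockOf (L ^ k) x with hBdef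
  set nH := hamNorm (fieldWt h (L : ℝ) d k) ((L : ℝ) ^ k) (L ^ (d * k)) H with hnH
  set AH := stepOpA (gradCov 𝒞q) H with hAH
  have hL0 : (0 : ℝ) < L := by exact_mod_cast hLodd.pos
  have hL1 : 1 ≤ L := hLodd.pos
  have hk' : k + 1 ≤ N + 1 := by omega
  obtain ⟨t, ht⟩ : ∃ t, N = k + t := ⟨N - k, by omega⟩
  have hMt : M = L ^ k * L ^ t := by rw [← pow_add, ← ht]; exact hM
  have hcard : B.card = L ^ (d * k) := by
    rw [hBdef, card_blockOf hMt hLodd.pow hLodd.pow x, ← pow_mul, mul_comm]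
  have h𝔥 : 0 < fieldWt h (L : ℝ) d k := fieldWt_pos hh hL0 d k
  have hRk : (0 : ℝ) < (L : ℝ) ^ k := by positivity
  have hnH0 : 0 ≤ nH := hamNorm_nonneg h𝔥.le hRk.le _ _
  have hHB : hamNorm (fieldWt h (L : ℝ) d k) ((L : ℝ) ^ k) B.card H ≤ 1 / 8 := by
    rw [hcard]; linarith
  have hHB' : hamNorm (fieldWt h (L : ℝ) d k) ((L : ℝ) ^ k) B.card H ≤ 1 / 16 := by rw [hcard]; exact hH
  -- `‖A_k H‖ ≤ 2‖H‖ ≤ ⅛`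
  have hAH2 : hamNorm (fieldWt h (L : ℝ) d k) ((L : ℝ) ^ k) (L ^ (d * k)) AH ≤ 2 * nH :=
    hamNorm_stepOpA_abkm_le hd hL1 hh k hγ H
  have hAHB : hamNorm (fieldWt h (L : ℝ) d k) ((L : ℝ) ^ k) B.card AH ≤ 1 / 8 := by
    rw [hcard]; linarith
  have hBS : B ⊆ thicken (P.rad k) B := subset_thicken _ _
  have hgauge : P.gauge k B = fieldGauge (fieldWt h (L : ℝ) d k) ((L : ℝ) ^ k) p (thicken (P.rad k) B) := rfl
  -- the strong weight of `B` is below `w_k^B ≤ w_{k:k+1}^B`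
  have hSW : ∀ φ, expWeight (strongCoef h N k • derivForm (L : ℝ) k (diffIndex d Mord)
      (boxDensity (boxRad R L k) (boxWt (L : ℝ) d k) B)) φ ≤ W.weight k B φ :=
    fun φ => strongWeight_le_weight_abkm hB hδ₀ hδ₁ hh hh0 k (subset_refl B) φ
  have hwm : ∀ φ, W.weight k B φ ≤ W.midWeight k B φ := fun φ =>
    WeightData.weight_le_midWeight hB.dominated k B φ
  -- the two second-order brackets
  set F₁ : ((Fin d → ZMod M) → ℝ) → ℂ := fun ψ => expNegH H B ψ - 1 + eval H B ψ with hF₁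
  set F₂ : ((Fin d → ZMod M) → ℝ) → ℂ := fun ψ => expNegH AH B ψ - 1 + eval AH B ψ with hF₂
  have hF₁s := tayNormLE_expNegH_sub_one_add_strong_abkm (R := R) (Mord := Mord) hd hLodd hM hk hh hMord hp
    hBS r₀ hHB
  have hF₂s := tayNormLE_expNegH_sub_one_add_strong_abkm (R := R) (Mord := Mord) hd hLodd hM hk hh hMord hp
    hBS r₀ hAHB
  rw [← hgauge] at hF₁s hF₂s
  have hc₁ : 0 ≤ 256 * Real.exp (1 / 4) * hamNorm (fieldWt h (L : ℝ) d k) ((L : ℝ) ^ k) B.card H ^ 2 := by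
    positivity
  have hc₂ : 0 ≤ 256 * Real.exp (1 / 4) * hamNorm (fieldWt h (L : ℝ) d k) ((L : ℝ) ^ k) B.card AH ^ 2 := by
    positivity
  have hF₁w : TayNormLE (P.gauge k B) r₀ (W.weight k B) F₁
      (256 * Real.exp (1 / 4) * hamNorm (fieldWt h (L : ℝ) d k) ((L : ℝ) ^ k) B.card H ^ 2) :=
    hF₁s.mono_weight hc₁ hSW
  have hF₂w : TayNormLE (P.gauge k B) r₀ (W.midWeight k B) F₂
      (256 * Real.exp (1 / 4) * hamNorm (fieldWt h (L : ℝ) d k) ((L : ℝ) ^ k) B.card AH ^ 2) :=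
    (hF₂s.mono_weight hc₂ hSW).mono_weight hc₂ hwm
  -- differentiability and locality
  have hF₁d : ContDiff ℝ r₀ F₁ :=
    (((contDiff_eval H B (n := r₀)).neg.cexp).sub contDiff_const).add (contDiff_eval H B)
  have hF₂d : ContDiff ℝ r₀ F₂ :=
    (((contDiff_eval AH B (n := r₀)).neg.cexp).sub contDiff_const).add (contDiff_eval AH B)
  have hev : IsGaugeLocal (P.gauge k B) (fun φ : (Fin d → ZMod M) → ℝ => eval H B φ) := by
    rw [hgauge]; exact isGaugeLocal_eval h𝔥.ne' hRk.ne' hp hBS H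
  have hevA : IsGaugeLocal (P.gauge k B) (fun φ : (Fin d → ZMod M) → ℝ => eval AH B φ) := by
    rw [hgauge]; exact isGaugeLocal_eval h𝔥.ne' hRk.ne' hp hBS AH
  have hF₁loc : IsGaugeLocal (P.gauge k B) F₁ := fun φ ψ hT => by
    simp only [hF₁, expNegH, hev φ ψ hT]
  have hexp_loc : IsGaugeLocal (P.gauge k B) (expNegH H B) := fun φ ψ hT => by
    simp only [expNegH, hev φ ψ hT]
  have hexp_d : ContDiff ℝ r₀ (expNegH H B) := by
    show ContDiff ℝ r₀ (fun φ : (Fin d → ZMod M) → ℝ => Complex.exp (-(eval H B φ)))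
    exact (contDiff_eval H B (n := r₀)).neg.cexp
  -- the block is a connected `k`-polymer with one block
  have hMo : Odd M := by rw [hM]; exact hLodd.pow
  have hBpoly : IsPolymer (L ^ k) B := isPolymer_blockOf _ x
  have hBconn : IsConn B := TorusPolymer.isConn_blockOf hMo hLodd.pow x
  have hnB : numBlocks (L ^ k) B = 1 := by
    rw [← card_blocks_eq_numBlocks, hBdef, blocks_blockOf, card_singleton]
  -- `R_{k+1}F₁`
  have hRF₁ : TayNormLE (P.gauge k B) r₀ (W.midWeight k B) (fluct 𝒞q F₁)
      (256 * Real.exp (1 / 4) * hamNorm (fieldWt h (L : ℝ) d k) ((L : ℝ) ^ k) B.card H ^ 2 * A𝒫') := by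
    have h := integrationProperty_of_stepKernelBounds hB hS p r₀ h A B hBpoly hBconn F₁ _ hc₁ hF₁d hF₁loc hF₁w
    have e : numBlocks (P.L ^ k) B = 1 := hnB
    rw [e, pow_one] at h
    exact h
  have hRF₁d : ContDiff ℝ r₀ (fluct 𝒞q F₁) :=
    hS.contDiff_fluct hB.dominated B (P.gauge k B) hc₁ hF₁d hF₁loc hF₁w
  -- the identity `D_B(H) = R F₁ − F₂`
  have hC := hS.posSemidef
  have hdom := hS.weightSectionDominated hB.dominated B (P.gauge k B)
  have hexp_s := tayNormLE_expNegH_strong_abkm (R := R) (Mord := Mord) hd hLodd hM hk hh hMord hp hBS r₀ hHB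
  rw [← hgauge] at hexp_s
  have hexp_w : TayNormLE (P.gauge k B) r₀ (W.weight k B) (expNegH H B) (Real.exp (1 / 4)) :=
    hexp_s.mono_weight (Real.exp_pos _).le hSW
  have hI : ∀ φ, Integrable (fun ξ => expNegH H B (φ + ξ)) (stepMeasure 𝒞q) := fun φ =>
    integrable_comp_add_of_tayNormLE hexp_w (Real.exp_pos _).le hexp_d hexp_loc hdom φ
  have hI2 : ∀ φ, Integrable (fun ξ => F₁ (φ + ξ)) (stepMeasure 𝒞q) := fun φ =>
    integrable_comp_add_of_tayNormLE hF₁w hc₁ hF₁d hF₁loc hdom φ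
  have heq : fluctDefect 𝒞q H B = fluct 𝒞q F₁ + (-1 : ℝ) • F₂ := by
    funext φ
    rw [fluctDefect_eq hC H B hI hI2 φ, Pi.add_apply, Pi.smul_apply, neg_one_smul, ← sub_eq_add_neg]
  rw [heq]
  -- combine
  have hsum := hRF₁.add (hF₂w.smul hF₂d (-1)) hRF₁d (hF₂d.const_smul (-1 : ℝ))
  refine hsum.mono ?_ (fun φ => (W.midWeight_pos k B φ).le)
  rw [hcard, ← hnH, abs_neg, abs_one, one_mul]
  have hAq : hamNorm (fieldWt h (L : ℝ) d k) ((L : ℝ) ^ k) (L ^ (d * k)) AH ^ 2 ≤ (2 * nH) ^ 2 :=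
    pow_le_pow_left₀ (hamNorm_nonneg h𝔥.le hRk.le _ _) hAH2 2
  have he : 0 ≤ 256 * Real.exp (1 / 4) := by positivity
  nlinarith [mul_le_mul_of_nonneg_left hAq he, sq_nonneg nH]

/-- **Lipschitz bound of the fluctuation defect** for the torus data: on the block `B = B_x` at scale
`k ≤ N` (`d ≥ 2`, `L` odd, `M = L^N`, `AbkmWeightBounds` with `A_𝒫 ≥ 0`, `θ̄, λ, δ₀, δ₁ > 0`,
`h² ≥ h₀²`, `⌊d/2⌋+1 ≤ min(p, M_ord)`, shift `L^{dk}|γ_q| ≤ h²` for `γ = gradCov 𝒞_{k+1}`) and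
`‖H‖_{k,0}, ‖H'‖_{k,0} ≤ 1/64` (at `(𝔥_k, L^k, L^{dk})`):
`|D_B(H) − D_B(H')|_{k,B,T_φ} ≤ 512e^{1/4}(A_𝒫 + 4)(‖H‖_{k,0} + ‖H'‖_{k,0})‖H − H'‖_{k,0} · w_{k:k+1}^B(φ)`.
[cite: AdamsBuchholzKoteckyMuller2019, Theorem 6.8 ((6.56), (6.61)–(6.64))] -/
theorem tayNormLE_fluctDefect_sub_abkm_of_stepKernelBounds {L N Mord R n p r₀ : ℕ} {θbar lam μ δ₁ δ₀ A𝒫 A𝒫' C₂ h A : ℝ}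
    {𝒞 : ℕ → (Fin d → ZMod M) → ℝ} (hd : 2 ≤ d)
    (hB : AbkmWeightBounds L N Mord R n θbar lam μ δ₁ δ₀ A𝒫 𝒞
      (abkmWeightData L N Mord R θbar (schedDelta δ₀ δ₁ N) 𝒞)) (hA𝒫' : 0 ≤ A𝒫')
    (hLodd : Odd L) (hM : M = L ^ N) {k : ℕ} (hk : k ≤ N)
    {𝒞q : (Fin d → ZMod M) → ℝ} (hS : StepKernelBounds (abkmWeightData L N Mord R θbar (schedDelta δ₀ δ₁ N) 𝒞) L k A𝒫' C₂ 𝒞q) (hδ₀ : 0 < δ₀) (hδ₁ : 0 < δ₁) (hh : 0 < h)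
    (hh0 : hZeroSq d R δ₀ δ₁ ≤ h ^ 2) (hMord : d / 2 + 1 ≤ Mord) (hp : d / 2 + 1 ≤ p)
    (hγ : ∀ q, ((L ^ (d * k) : ℕ) : ℝ) * |gradCov 𝒞q q| ≤ h ^ 2)
    (x : Fin d → ZMod M) {H H' : RelevantHamiltonian ℂ d}
    (hH : hamNorm (fieldWt h (L : ℝ) d k) ((L : ℝ) ^ k) (L ^ (d * k)) H ≤ 1 / 64)
    (hH' : hamNorm (fieldWt h (L : ℝ) d k) ((L : ℝ) ^ k) (L ^ (d * k)) H' ≤ 1 / 64) :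
    TayNormLE ((abkmNormParams L N Mord R p r₀ h θbar A (schedDelta δ₀ δ₁ N) 𝒞).gauge k (blockOf (L ^ k) x))
      r₀ ((abkmWeightData L N Mord R θbar (schedDelta δ₀ δ₁ N) 𝒞).midWeight k (blockOf (L ^ k) x))
      (fun φ => fluctDefect 𝒞q H (blockOf (L ^ k) x) φ - fluctDefect 𝒞q H' (blockOf (L ^ k) x) φ)
      (512 * Real.exp (1 / 4) * (A𝒫' + 4) *
        (hamNorm (fieldWt h (L : ℝ) d k) ((L : ℝ) ^ k) (L ^ (d * k)) H +
          hamNorm (fieldWt h (L : ℝ) d k) ((L : ℝ) ^ k) (L ^ (d * k)) H') *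
        hamNorm (fieldWt h (L : ℝ) d k) ((L : ℝ) ^ k) (L ^ (d * k)) (H - H')) := by
  set P := abkmNormParams L N Mord R p r₀ h θbar A (schedDelta δ₀ δ₁ N) 𝒞 with hP
  set W := abkmWeightData L N Mord R θbar (schedDelta δ₀ δ₁ N) 𝒞 with hW
  set B := blockOf (L ^ k) x with hBdef
  set Δ := H - H' with hΔ
  set 𝒸 := 𝒞q with h𝒸
  set AH' := stepOpA (gradCov 𝒸) H' with hAH'
  set AΔ := stepOpA (gradCov 𝒸) Δ with hAΔ
  set nH := hamNorm (fieldWt h (L : ℝ) d k) ((L : ℝ) ^ k) (L ^ (d * k)) H with hnH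
  set nH' := hamNorm (fieldWt h (L : ℝ) d k) ((L : ℝ) ^ k) (L ^ (d * k)) H' with hnH'
  set nΔ := hamNorm (fieldWt h (L : ℝ) d k) ((L : ℝ) ^ k) (L ^ (d * k)) Δ with hnΔ
  have hL0 : (0 : ℝ) < L := by exact_mod_cast hLodd.pos
  have hL1 : 1 ≤ L := hLodd.pos
  have hk' : k + 1 ≤ N + 1 := by omega
  obtain ⟨t, ht⟩ : ∃ t, N = k + t := ⟨N - k, by omega⟩
  have hMt : M = L ^ k * L ^ t := by rw [← pow_add, ← ht]; exact hM
  have hcard : B.card = L ^ (d * k) := by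
    rw [hBdef, card_blockOf hMt hLodd.pow hLodd.pow x, ← pow_mul, mul_comm]
  have h𝔥 : 0 < fieldWt h (L : ℝ) d k := fieldWt_pos hh hL0 d k
  have hRk : (0 : ℝ) < (L : ℝ) ^ k := by positivity
  have hnH0 : 0 ≤ nH := hamNorm_nonneg h𝔥.le hRk.le _ _
  have hnH'0 : 0 ≤ nH' := hamNorm_nonneg h𝔥.le hRk.le _ _
  have hnΔ0 : 0 ≤ nΔ := hamNorm_nonneg h𝔥.le hRk.le _ _
  have hnΔle : nΔ ≤ nH + nH' := hamNorm_sub_le h𝔥.le hRk.le _ H H'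
  have hnΔ16 : nΔ ≤ 1 / 16 := by linarith
  -- norms of `A H'`, `A Δ`
  have hAH'2 : hamNorm (fieldWt h (L : ℝ) d k) ((L : ℝ) ^ k) (L ^ (d * k)) AH' ≤ 2 * nH' :=
    hamNorm_stepOpA_abkm_le hd hL1 hh k hγ H'
  have hAΔ2 : hamNorm (fieldWt h (L : ℝ) d k) ((L : ℝ) ^ k) (L ^ (d * k)) AΔ ≤ 2 * nΔ :=
    hamNorm_stepOpA_abkm_le hd hL1 hh k hγ Δ
  have hBS : B ⊆ thicken (P.rad k) B := subset_thicken _ _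
  have hgauge : P.gauge k B = fieldGauge (fieldWt h (L : ℝ) d k) ((L : ℝ) ^ k) p (thicken (P.rad k) B) := rfl
  -- weights: strong ≤ weak ≤ mid
  have hSW : ∀ φ, expWeight (strongCoef h N k • derivForm (L : ℝ) k (diffIndex d Mord)
      (boxDensity (boxRad R L k) (boxWt (L : ℝ) d k) B)) φ ≤ W.weight k B φ :=
    fun φ => strongWeight_le_weight_abkm hB hδ₀ hδ₁ hh hh0 k (subset_refl B) φ
  have hwm : ∀ φ, W.weight k B φ ≤ W.midWeight k B φ := fun φ =>
    WeightData.weight_le_midWeight hB.dominated k B φ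
  -- locality helpers
  have hev : ∀ G : RelevantHamiltonian ℂ d, IsGaugeLocal (P.gauge k B)
      (fun φ : (Fin d → ZMod M) → ℝ => eval G B φ) := fun G => by
    rw [hgauge]; exact isGaugeLocal_eval h𝔥.ne' hRk.ne' hp hBS G
  have hexp_loc : ∀ G : RelevantHamiltonian ℂ d, IsGaugeLocal (P.gauge k B) (expNegH G B) :=
    fun G φ ψ hT => by simp only [expNegH, hev G φ ψ hT]
  have hexp_d : ∀ G : RelevantHamiltonian ℂ d, ContDiff ℝ r₀ (expNegH G B) := fun G => by
    show ContDiff ℝ r₀ (fun φ : (Fin d → ZMod M) → ℝ => Complex.exp (-(eval G B φ)))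
    exact (contDiff_eval G B (n := r₀)).neg.cexp
  have hsub1_d : ∀ G : RelevantHamiltonian ℂ d, ContDiff ℝ r₀ (fun φ => expNegH G B φ - 1) :=
    fun G => (hexp_d G).sub contDiff_const
  have hsub1_loc : ∀ G : RelevantHamiltonian ℂ d, IsGaugeLocal (P.gauge k B) (fun φ => expNegH G B φ - 1) :=
    fun G φ ψ hT => by simp only [expNegH, hev G φ ψ hT]
  -- the block, polymer facts
  have hMo : Odd M := by rw [hM]; exact hLodd.pow
  have hBpoly : IsPolymer (L ^ k) B := isPolymer_blockOf _ x
  have hnB : numBlocks (L ^ k) B = 1 := by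
    rw [← card_blocks_eq_numBlocks, hBdef, blocks_blockOf, card_singleton]
  have hC := hS.posSemidef
  have hdom := hS.weightSectionDominated hB.dominated B (P.gauge k B)
  -- (1) the product `(e^{−H'} − 1)(e^{−Δ} − 1)` and its fluctuation integral
  set Pr : ((Fin d → ZMod M) → ℝ) → ℂ := fun ψ => (expNegH H' B ψ - 1) * (expNegH Δ B ψ - 1) with hPr
  have hH'B : hamNorm (fieldWt h (L : ℝ) d k) ((L : ℝ) ^ k) B.card H' ≤ 1 / 16 := by rw [hcard]; linarith
  have hΔB : hamNorm (fieldWt h (L : ℝ) d k) ((L : ℝ) ^ k) B.card Δ ≤ 1 / 16 := by rw [hcard]; exact hnΔ16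
  have hPr_s := tayNormLE_expNegH_sub_one_mul_strong_abkm (R := R) (Mord := Mord) hd hLodd hM hk hh hMord hp
    hBS r₀ hH'B hΔB
  rw [← hgauge, hcard] at hPr_s
  have hc1 : 0 ≤ 256 * Real.exp (1 / 4) * nH' * nΔ := by positivity
  have hPr_w : TayNormLE (P.gauge k B) r₀ (W.weight k B) Pr (256 * Real.exp (1 / 4) * nH' * nΔ) :=
    hPr_s.mono_weight hc1 hSW
  have hPr_d : ContDiff ℝ r₀ Pr := (hsub1_d H').mul (hsub1_d Δ)
  have hPr_loc : IsGaugeLocal (P.gauge k B) Pr := (hsub1_loc H').mul (hsub1_loc Δ)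
  have hRPr : TayNormLE (P.gauge k B) r₀ (W.midWeight k B) (fluct 𝒸 Pr)
      (256 * Real.exp (1 / 4) * nH' * nΔ * A𝒫') := by
    have h1 := integrationProperty_of_stepKernelBounds hB hS p r₀ h A B hBpoly
      (TorusPolymer.isConn_blockOf hMo hLodd.pow x) Pr _ hc1 hPr_d hPr_loc hPr_w
    have e : numBlocks (P.L ^ k) B = 1 := hnB
    rw [e, pow_one] at h1
    exact h1
  have hRPr_d : ContDiff ℝ r₀ (fluct 𝒸 Pr) :=
    hS.contDiff_fluct hB.dominated B (P.gauge k B) hc1 hPr_d hPr_loc hPr_w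
  -- (2) the product `(e^{−AH'} − 1)(e^{−AΔ} − 1)`
  set Pa : ((Fin d → ZMod M) → ℝ) → ℂ := fun ψ => (expNegH AH' B ψ - 1) * (expNegH AΔ B ψ - 1) with hPa
  have hAH'B : hamNorm (fieldWt h (L : ℝ) d k) ((L : ℝ) ^ k) B.card AH' ≤ 1 / 16 := by rw [hcard]; linarith
  have hAΔB : hamNorm (fieldWt h (L : ℝ) d k) ((L : ℝ) ^ k) B.card AΔ ≤ 1 / 16 := by rw [hcard]; linarith
  have hPa_s := tayNormLE_expNegH_sub_one_mul_strong_abkm (R := R) (Mord := Mord) hd hLodd hM hk hh hMord hp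
    hBS r₀ hAH'B hAΔB
  rw [← hgauge, hcard] at hPa_s
  have hc2 : 0 ≤ 256 * Real.exp (1 / 4) * hamNorm (fieldWt h (L : ℝ) d k) ((L : ℝ) ^ k) (L ^ (d * k)) AH' *
      hamNorm (fieldWt h (L : ℝ) d k) ((L : ℝ) ^ k) (L ^ (d * k)) AΔ := by
    have := hamNorm_nonneg h𝔥.le hRk.le (L ^ (d * k)) AH'
    have := hamNorm_nonneg h𝔥.le hRk.le (L ^ (d * k)) AΔ
    positivity
  have hPa_w : TayNormLE (P.gauge k B) r₀ (W.midWeight k B) Pa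
      (256 * Real.exp (1 / 4) * hamNorm (fieldWt h (L : ℝ) d k) ((L : ℝ) ^ k) (L ^ (d * k)) AH' *
        hamNorm (fieldWt h (L : ℝ) d k) ((L : ℝ) ^ k) (L ^ (d * k)) AΔ) :=
    (hPa_s.mono_weight hc2 hSW).mono_weight hc2 hwm
  have hPa_d : ContDiff ℝ r₀ Pa := (hsub1_d AH').mul (hsub1_d AΔ)
  -- (3) the defect of `Δ`
  have hDΔ := tayNormLE_fluctDefect_abkm_of_stepKernelBounds (p := p) (r₀ := r₀) (A := A) hd hB hLodd hM hk hS
    hδ₀ hδ₁ hh hh0 hMord hp hγ x (H := Δ) hnΔ16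
  have hc3 : 0 ≤ 256 * Real.exp (1 / 4) * (A𝒫' + 4) * nΔ ^ 2 := by positivity
  -- integrability and the identity
  have hexp_s : ∀ G : RelevantHamiltonian ℂ d, hamNorm (fieldWt h (L : ℝ) d k) ((L : ℝ) ^ k) B.card G ≤ 1 / 8 →
      ∀ φ, Integrable (fun ξ => expNegH G B (φ + ξ)) (stepMeasure 𝒸) := by
    intro G hG φ
    have hs := tayNormLE_expNegH_strong_abkm (R := R) (Mord := Mord) hd hLodd hM hk hh hMord hp hBS r₀ hG
    rw [← hgauge] at hs
    exact integrable_comp_add_of_tayNormLE (hs.mono_weight (Real.exp_pos _).le hSW) (Real.exp_pos _).le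
      (hexp_d G) (hexp_loc G) hdom φ
  have hIH' := hexp_s H' (by linarith)
  have hIΔ := hexp_s Δ (by linarith)
  have hIPr : ∀ φ, Integrable (fun ξ => Pr (φ + ξ)) (stepMeasure 𝒸) := fun φ =>
    integrable_comp_add_of_tayNormLE hPr_w hc1 hPr_d hPr_loc hdom φ
  have hDΔ_d : ContDiff ℝ r₀ (fluctDefect 𝒸 Δ B) := by
    have hs := tayNormLE_expNegH_strong_abkm (R := R) (Mord := Mord) hd hLodd hM hk hh hMord hp hBS r₀
      (show hamNorm (fieldWt h (L : ℝ) d k) ((L : ℝ) ^ k) B.card Δ ≤ 1 / 8 by linarith)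
    rw [← hgauge] at hs
    have h1 : ContDiff ℝ r₀ (fluct 𝒸 (expNegH Δ B)) :=
      hS.contDiff_fluct hB.dominated B (P.gauge k B) (Real.exp_pos _).le (hexp_d Δ) (hexp_loc Δ)
        (hs.mono_weight (Real.exp_pos _).le hSW)
    show ContDiff ℝ r₀ (fun φ => fluct 𝒸 (expNegH Δ B) φ - expNegH (stepOpA (gradCov 𝒸) Δ) B φ)
    exact h1.sub (hexp_d _)
  haveI := isProbabilityMeasure_stepMeasure 𝒸
  have hHsum : H = H' + Δ := by rw [hΔ]; abel
  have heq : (fun φ => fluctDefect 𝒸 H B φ - fluctDefect 𝒸 H' B φ) =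
      fluct 𝒸 Pr + ((-1 : ℝ) • Pa + fluctDefect 𝒸 Δ B) := by
    funext φ
    simp only [Pi.add_apply, neg_one_smul]
    -- pointwise factorisations
    have hfacH : ∀ ψ, expNegH H B ψ = expNegH H' B ψ * expNegH Δ B ψ := fun ψ => by
      simp only [expNegH]
      rw [hHsum, eval_add, neg_add, Complex.exp_add]
    have hfacA : ∀ ψ, expNegH (stepOpA (gradCov 𝒸) H) B ψ = expNegH AH' B ψ * expNegH AΔ B ψ := fun ψ => by
      simp only [expNegH, hAH', hAΔ]
      rw [hHsum, stepOpA_add, eval_add, neg_add, Complex.exp_add]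
    -- the fluctuation integral of `e^{−H}`
    have hint : fluct 𝒸 (expNegH H B) φ = fluct 𝒸 Pr φ + fluct 𝒸 (expNegH Δ B) φ + fluct 𝒸 (expNegH H' B) φ - 1 := by
      unfold fluct
      have hptw : ∀ ξ, expNegH H B (φ + ξ) =
          Pr (φ + ξ) + (expNegH Δ B (φ + ξ) + (expNegH H' B (φ + ξ) - 1)) := fun ξ => by
        rw [hfacH]; simp only [hPr]; ring
      simp_rw [hptw]
      have i3 : Integrable (fun ξ => expNegH H' B (φ + ξ) - 1) (stepMeasure 𝒸) :=
        (hIH' φ).sub (integrable_const _)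
      have i23 : Integrable (fun ξ => expNegH Δ B (φ + ξ) + (expNegH H' B (φ + ξ) - 1)) (stepMeasure 𝒸) :=
        (hIΔ φ).add i3
      rw [integral_add (hIPr φ) i23, integral_add (hIΔ φ) i3, integral_sub (hIH' φ) (integrable_const _)]
      simp only [integral_const, probReal_univ, one_smul]
      ring
    show fluctDefect 𝒸 H B φ - fluctDefect 𝒸 H' B φ = fluct 𝒸 Pr φ + (-(Pa φ) + fluctDefect 𝒸 Δ B φ)
    unfold fluctDefect
    rw [hint, hfacA, ← hAH', ← hAΔ]
    simp only [hPa]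
    ring
  rw [heq]
  -- combine the three bounds
  have hsum := (hRPr.add ((hPa_w.smul hPa_d (-1)).add hDΔ (hPa_d.const_smul (-1 : ℝ)) hDΔ_d) hRPr_d
    ((hPa_d.const_smul (-1 : ℝ)).add hDΔ_d))
  refine hsum.mono ?_ (fun φ => (W.midWeight_pos k B φ).le)
  rw [abs_neg, abs_one, one_mul]
  have hAprod : hamNorm (fieldWt h (L : ℝ) d k) ((L : ℝ) ^ k) (L ^ (d * k)) AH' *
      hamNorm (fieldWt h (L : ℝ) d k) ((L : ℝ) ^ k) (L ^ (d * k)) AΔ ≤ (2 * nH') * (2 * nΔ) :=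
    mul_le_mul hAH'2 hAΔ2 (hamNorm_nonneg h𝔥.le hRk.le _ _) (by positivity)
  have he : 0 ≤ 256 * Real.exp (1 / 4) := by positivity
  have hsq : nΔ ^ 2 ≤ (nH + nH') * nΔ := by rw [sq]; exact mul_le_mul_of_nonneg_right hnΔle hnΔ0
  have hA4 : 0 ≤ A𝒫' + 4 := by linarith
  nlinarith [mul_le_mul_of_nonneg_left hAprod he, mul_le_mul_of_nonneg_left hsq (mul_nonneg he hA4),
    mul_nonneg (mul_nonneg he hA𝒫') (mul_nonneg hnH0 hnΔ0), mul_nonneg he (mul_nonneg hnH'0 hnΔ0),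
    mul_nonneg (mul_nonneg he hA𝒫') (mul_nonneg hnH'0 hnΔ0), mul_nonneg he (mul_nonneg hnH0 hnΔ0)]

end Literature.MathematicalPhysics.StatisticalMechanics.GradientRG

end
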